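import Literature.Topology.FourManifolds.Collapsible
import Literature.Barriers.KontsevichZagierPeriods.HauptvermutungObstruction
import HarnessLib

/-!
# Whitehead: a collapsible compact PL manifold is a PL ball; two PL balls glued along their
# boundaries form a PL sphere

Named facts (D-0014) for the cite item `wi-25745`, wanted by route SmoothPoincare4/LogCYSkeleton
(support `CertificateRecognition`, `stmt-SmoothPoincare4-13646`; informal crux
`BirationalCertificate`, 13665): the two classical PL facts in the chain "antistar of a vertex
collapsible ⇒ PL 4-ball (Whitehead); star = cone on the link = PL ball; ball ∪_∂ ball ≅_PL S⁴
(Alexander)".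

* **Whitehead 1939** (Rourke–Sanderson 1972, Cor. 3.27; quoted from [Lange2016, Lemma 5.7], read:
  *"A collapsible PL `n`-manifold (with or without boundary) is a PL `n`-ball."*) —
  `Whitehead1939_collapsible_PLManifold_PLBall`.
* **Gluing / Alexander trick** ([Lange2016, Lemma 5.6], read: *"Suppose `B₁ⁿ` and `B₂ⁿ` are PL
  balls and `φ : ∂B₁ⁿ → ∂B₂ⁿ` is a PL homeomorphism. Then the space `B₁ⁿ ∪_φ B₂ⁿ` obtained by
  gluing `B₁ⁿ` and `B₂ⁿ` together along their boundary via `φ` is a PL `n`-sphere."* — proof: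
  radial extension of a PL homeomorphism `∂Δⁿ → ∂Δⁿ` to `Δⁿ`, [RourkeSanderson1972]) —
  `Lange2016_union_PLBalls_PLSphere`, in the EMBEDDED form the route needs (two compact polyhedra
  in `ℝᴺ` meeting exactly in their common boundary sphere), which follows from the printed
  abstract form because the canonical map `B₁ ∪_φ B₂ → P₁ ∪ P₂` is then a PL bijection of compact
  polyhedra, hence a PL homeomorphism.

## How the statements are typed

Everything is Euclidean PL topology of compact polyhedra in `ℝᴺ = (Fin N → ℝ)`, with the tree's
vocabulary: geometric simplicial complexes `Geometry.SimplicialComplex ℝ (Fin N → ℝ)` (Mathlib)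
and simplicial collapsibility `IsCollapsible` (`Collapsible.lean`: elementary collapses down to
a vertex — a special kind of triangulation-level collapse, so "`K` collapsible" implies that the
PL space `|K|` is collapsible in the sense of [Lange2016, §5.7] / Rourke–Sanderson Ch. 3);
PL maps / PL homeomorphisms of compact polyhedra
`Literature.Barriers.KontsevichZagierPeriods.PL.IsPLMapOn` / `.PLHomeomorphic` (continuous and
affine on the simplices of a finite simplicial cover; mutually inverse such maps); PL
`n`-manifold with boundary in the sense of [Lange2016, §3.1] — every point has a neighbourhood
within `P` PL homeomorphic to the standard simplex `Δⁿ` — written out inline (it is literally the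
definiens of `IsPLManifoldWithBoundaryIn n P` of `LinearQuotientPL.lean`, inlined to keep this
file's imports light);
the standard PL `n`-ball is `Δⁿ = stdSimplex ℝ (Fin (n + 1))` and the standard PL `n`-sphere is
`∂Δⁿ⁺¹ = stdSimplexBoundary (n + 1)` ([Lange2016, §3.1]). A PL `n`-ball `P` WITH ITS BOUNDARY
`B` is recorded by an explicit PL homeomorphism `Δⁿ → P` carrying `∂Δⁿ` onto `B`
(`IsPLBallWithBoundary`; the boundary of a PL ball does not depend on the chart, by invariance
of domain, but we do not need that here).

Complexes in `EuclideanSpace ℝ (Fin N)` (as in `IsSmoothTriangulation`) are transported to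
`Fin N → ℝ` along the continuous linear equivalence `EuclideanSpace.equiv`
(cf. `Literature.Analysis.Convexity.ComplexTransport`); collapsibility is a statement about the
face poset and is unchanged.

Deliberately NOT here: regular neighbourhoods of collapsible polyhedra are balls
(Rourke–Sanderson 3.11/3.27 in full), "the antistar of a vertex of a combinatorial manifold is a
PL manifold with boundary the link" (needs combinatorial-manifold vocabulary: links are PL
spheres), uniqueness of the boundary. The originals [Whitehead1939] and [RourkeSanderson1972]
were not re-readable in this session (not held); the statements were checked against the held
copy of [Lange2016], Lemmas 5.6–5.7 and §3.1.

## References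

* J. H. C. Whitehead, *Simplicial spaces, nuclei and m-groups*, Proc. LMS 45 (1939) 243–327, §3,
  Thm. 23 and Cor. [Whitehead1939]
* C. P. Rourke, B. J. Sanderson, *Introduction to piecewise-linear topology*, Springer 1972,
  Cor. 3.27 (collapsible PL manifold is a ball), Ch. 3 (radial extension, 3.22–3.23).
  [RourkeSanderson1972]
* C. Lange, *Characterization of finite groups generated by reflections and rotations*,
  J. Topology 9 (2016) = arXiv:1509.06771, §3.1, Lemma 5.6, Lemma 5.7 (read). [Lange2016]
-/

noncomputable section

open Set
open _root_.Topology
open Literature.Barriers.KontsevichZagierPeriods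

namespace Literature.Topology.FourManifolds

/-! ### Standard PL balls and spheres; PL balls with boundary -/

section Standard

/-- The boundary `∂Δⁿ` of the standard `n`-simplex `Δⁿ = stdSimplex ℝ (Fin (n + 1))`: the points
of `Δⁿ` with some vanishing barycentric coordinate — the standard PL `(n − 1)`-sphere
([Lange2016, §3.1]). [cite: Lange2016, §3.1 (standard PL ball and sphere)] -/
def stdSimplexBoundary (n : ℕ) : Set (Fin (n + 1) → ℝ) :=
  {x | x ∈ stdSimplex ℝ (Fin (n + 1)) ∧ ∃ i, x i = 0}

/-- Membership in `stdSimplexBoundary`. [folklore] -/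
@[simp] theorem mem_stdSimplexBoundary_iff {n : ℕ} (x : Fin (n + 1) → ℝ) :
    x ∈ stdSimplexBoundary n ↔ x ∈ stdSimplex ℝ (Fin (n + 1)) ∧ ∃ i, x i = 0 :=
  Iff.rfl

/-- `∂Δⁿ ⊆ Δⁿ`. [folklore] -/
theorem stdSimplexBoundary_subset (n : ℕ) : stdSimplexBoundary n ⊆ stdSimplex ℝ (Fin (n + 1)) :=
  fun _ hx => hx.1

/-- **PL `n`-ball with boundary.** `P ⊆ ℝᴺ` is a PL `n`-ball whose boundary is `B`: there are
mutually inverse PL maps `f : Δⁿ → P`, `g : P → Δⁿ` (a PL homeomorphism in the sense of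
`PL.PLHomeomorphic`) with `f(∂Δⁿ) = B`. [cite: Lange2016, §3.1 (PL balls, PL homeomorphisms)] -/
def IsPLBallWithBoundary (n : ℕ) {N : ℕ} (P B : Set (Fin N → ℝ)) : Prop :=
  ∃ (f : (Fin (n + 1) → ℝ) → (Fin N → ℝ)) (g : (Fin N → ℝ) → (Fin (n + 1) → ℝ)),
    MapsTo f (stdSimplex ℝ (Fin (n + 1))) P ∧ MapsTo g P (stdSimplex ℝ (Fin (n + 1))) ∧
    (∀ x ∈ stdSimplex ℝ (Fin (n + 1)), g (f x) = x) ∧ (∀ y ∈ P, f (g y) = y) ∧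
    PL.IsPLMapOn (stdSimplex ℝ (Fin (n + 1))) f ∧ PL.IsPLMapOn P g ∧
    f '' stdSimplexBoundary n = B

/-- A PL ball with boundary is PL homeomorphic to the standard simplex. [folklore] -/
theorem IsPLBallWithBoundary.plHomeomorphic {n N : ℕ} {P B : Set (Fin N → ℝ)}
    (h : IsPLBallWithBoundary n P B) : PL.PLHomeomorphic P (stdSimplex ℝ (Fin (n + 1))) := by
  obtain ⟨f, g, hf, hg, hgf, hfg, hfPL, hgPL, -⟩ := h
  exact ⟨g, f, hg, hf, hfg, hgf, hgPL, hfPL⟩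

/-- The boundary of a PL ball with boundary lies in the ball. [folklore] -/
theorem IsPLBallWithBoundary.boundary_subset {n N : ℕ} {P B : Set (Fin N → ℝ)}
    (h : IsPLBallWithBoundary n P B) : B ⊆ P := by
  obtain ⟨f, g, hf, -, -, -, -, -, rfl⟩ := h
  rintro _ ⟨x, hx, rfl⟩
  exact hf (stdSimplexBoundary_subset n hx)

end Standard

/-! ### The named facts -/

/-- **Whitehead 1939 — a collapsible compact PL manifold is a PL ball** (Rourke–Sanderson 1972,
Cor. 3.27; [Lange2016, Lemma 5.7]: *"A collapsible PL `n`-manifold (with or without boundary) is a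
PL `n`-ball."*). Typed: if a (finite) geometric simplicial complex `K` in `ℝᴺ` is simplicially
collapsible (`IsCollapsible K`, so in particular `|K|` is a compact collapsible polyhedron) and
its underlying space `|K|` is a PL `n`-manifold with boundary ([Lange2016, §3.1]: every point has
a neighbourhood in `|K|` PL homeomorphic to `Δⁿ`; = `IsPLManifoldWithBoundaryIn n K.space` of
`LinearQuotientPL.lean`, inlined), then `|K|` is PL homeomorphic
to the standard `n`-simplex `Δⁿ`. (For a CLOSED manifold the hypotheses force `n = 0`, a point.)
Grounds the cite item `wi-25745` (route SmoothPoincare4/LogCYSkeleton, CertificateRecognition).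
[cite: Whitehead1939, §3 Thm. 23 Cor.] [cite: Lange2016, Lemma 5.7] -/
def Whitehead1939_collapsible_PLManifold_PLBall : Prop :=
  ∀ (N n : ℕ) (K : Geometry.SimplicialComplex ℝ (Fin N → ℝ)), IsCollapsible K →
    (∀ y ∈ K.space, ∃ P : Set (Fin N → ℝ), P ⊆ K.space ∧ P ∈ 𝓝[K.space] y ∧
      PL.PLHomeomorphic P (stdSimplex ℝ (Fin (n + 1)))) →
    PL.PLHomeomorphic K.space (stdSimplex ℝ (Fin (n + 1)))

/-- **Two PL `n`-balls glued along their boundaries form a PL `n`-sphere** ([Lange2016, Lemma 5.6]: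
*"Suppose `B₁ⁿ` and `B₂ⁿ` are PL balls and `φ : ∂B₁ⁿ → ∂B₂ⁿ` is a PL homeomorphism. Then the space
`B₁ⁿ ∪_φ B₂ⁿ` … is a PL `n`-sphere"*; the Alexander trick: extend a PL homeomorphism `∂Δⁿ → ∂Δⁿ`
radially, Rourke–Sanderson Ch. 3), embedded form: if two compact polyhedra `P₁, P₂ ⊆ ℝᴺ` are PL
`n`-balls with the same boundary `B` (`IsPLBallWithBoundary n Pᵢ B`) and meet exactly in `B`,
then `P₁ ∪ P₂` is PL homeomorphic to the standard PL `n`-sphere `∂Δⁿ⁺¹`. Grounds the cite item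
`wi-25745`. [cite: Lange2016, Lemma 5.6] -/
def Lange2016_union_PLBalls_PLSphere : Prop :=
  ∀ (N n : ℕ) (P₁ P₂ B : Set (Fin N → ℝ)),
    IsPLBallWithBoundary n P₁ B → IsPLBallWithBoundary n P₂ B → P₁ ∩ P₂ = B →
      PL.PLHomeomorphic (P₁ ∪ P₂) (stdSimplexBoundary (n + 1))

end Literature.Topology.FourManifolds

end
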